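import Summits.CriticalPhenomena.PercolationContinuityZ3.Theorems.PercNearOneGluingNoHeavyLowerTailAntitheticFirmSliceTools
import HarnessLib

/-!
# `NoHeavyLowerTail` (stmt-CriticalPhenomena-4575) — antithetic cluster pairs: THEOREM D⁺, part 2 (blue lobes of a colouring)
# (prim-hp-2 gen 50/52, MEMO-gen50 §2 (L2⁺))

Support file (`--supports stmt-CriticalPhenomena-4575`, hull-port prover `prim-hp-2`).  No named facts, no sorries; standard axioms.  The
`def`s (`Antithetic.Firm.innerB/lobe/Lobes`) are proof-internal bookkeeping, continuing `…AntitheticFirmSliceTools`: the BLUE LOBES of a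
colouring `x` (components of the blue-only region `bo x = W' ∖ W` under the edges of `E`), closedness of lobes, closed sets as unions of lobes,
and injectivity of the flip map `T ↦ x ∆ fl (⋃ T)` on sets of lobes — used by `…AntitheticFirmSlice` to index the flip family of a bleached firm
colouring by the power set of its lobes (THEOREM D⁺, `Antithetic.Firm.firm_slice_nonneg`).
[cite: VandenbergHaggstromKahn2005, §1 p. 3 (open cluster `C_s`)]
-/

noncomputable section

namespace Summit.CriticalPhenomena.PercolationContinuityZ3.Theorems

open Literature.Probability.Percolation
open scoped Classical symmDiff

namespace Antithetic

namespace Firm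

variable {V : Type*}

section Lobes

variable {E : Set (Sym2 V)} {s : V}

/-- edges of `E` inside the blue-only region of `x`. [this work] -/
def innerB (E : Set (Sym2 V)) (s : V) (x : Set (Sym2 V)) : Set (Sym2 V) := {e | e ∈ E ∧ ∀ w ∈ e, w ∈ bo E s x}
/-- the blue LOBE of `v`: its component in the blue-only region. [this work] -/
def lobe (E : Set (Sym2 V)) (s : V) (x : Set (Sym2 V)) (v : V) : Set V := openCluster (innerB E s x) v
/-- the set of blue lobes of `x`. [this work] -/
def Lobes (E : Set (Sym2 V)) (s : V) (x : Set (Sym2 V)) : Set (Set V) := {L | ∃ v ∈ bo E s x, L = lobe E s x v}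

/-- a walk along edges inside the blue-only region stays in the blue-only region. [this work] -/
theorem walk_bo {x : Set (Sym2 V)} : ∀ {a w : V} (_ : (openGraph (innerB E s x)).Walk a w), a ∈ bo E s x → w ∈ bo E s x := by
  intro a w p
  induction p with
  | nil => exact id
  | @cons a b c hab _ ih =>
    intro _
    rw [openGraph_adj] at hab
    exact ih (hab.1.2 b (Sym2.mem_mk_right a b))

/-- the lobe of a blue-only vertex consists of blue-only vertices. [this work] -/
theorem lobe_subset_bo {x : Set (Sym2 V)} {v : V} (hv : v ∈ bo E s x) : lobe E s x v ⊆ bo E s x := by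
  intro w hw; obtain ⟨p⟩ := hw; exact walk_bo p hv

/-- every vertex lies in its own lobe. [this work] -/
theorem mem_lobe_self {x : Set (Sym2 V)} (v : V) : v ∈ lobe E s x v := mem_openCluster_self _ _

/-- lobes are closed: an `E`-neighbour of a lobe vertex that is blue-only lies in the same lobe. [this work] -/
theorem lobe_closed {x : Set (Sym2 V)} {v : V} (hv : v ∈ bo E s x) {a b : V} (hE : s(a, b) ∈ E) (ha : a ∈ lobe E s x v)
    (hb : b ∈ bo E s x) : b ∈ lobe E s x v := by
  by_cases hab : a = b
  · rw [← hab]; exact ha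
  have haB : a ∈ bo E s x := lobe_subset_bo hv ha
  have hin : s(a, b) ∈ innerB E s x := ⟨hE, fun w hw => by
    rcases Sym2.mem_iff.1 hw with rfl | rfl
    · exact haB
    · exact hb⟩
  exact ha.trans ((openGraph_adj (innerB E s x) a b).2 ⟨hin, hab⟩).reachable

/-- a vertex of a lobe has the same lobe. [this work] -/
theorem lobe_eq_of_mem {x : Set (Sym2 V)} {v w : V} (hw : w ∈ lobe E s x v) : lobe E s x w = lobe E s x v := by
  ext u
  constructor
  · exact fun hu => SimpleGraph.Reachable.trans hw hu
  · exact fun hu => SimpleGraph.Reachable.trans hw.symm hu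

/-- a closed set of blue-only vertices contains the lobe of each of its vertices. [this work] -/
theorem lobe_subset_of_closed {x : Set (Sym2 V)} {S : Set V}
    (hcl : ∀ a b, s(a, b) ∈ E → a ∈ S → b ∈ bo E s x → b ∈ S) {v : V} (hv : v ∈ S) : lobe E s x v ⊆ S := by
  have key : ∀ {a w : V} (_ : (openGraph (innerB E s x)).Walk a w), a ∈ S → w ∈ S := by
    intro a w p
    induction p with
    | nil => exact id
    | @cons a b c hab _ ih =>
      intro ha
      rw [openGraph_adj] at hab
      exact ih (hcl a b hab.1.1 ha (hab.1.2 b (Sym2.mem_mk_right a b)))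
  intro w hw; obtain ⟨p⟩ := hw; exact key p hv

/-- unions of lobes are closed sets of blue-only vertices. [this work] -/
theorem union_lobes_closed (x : Set (Sym2 V)) (T : Set {L : Set V // L ∈ Lobes E s x}) :
    (⋃ L ∈ T, (L : Set V)) ⊆ bo E s x ∧
      ∀ a b, s(a, b) ∈ E → a ∈ (⋃ L ∈ T, (L : Set V)) → b ∈ bo E s x → b ∈ (⋃ L ∈ T, (L : Set V)) := by
  constructor
  · intro w hw
    obtain ⟨L, hLT, hwL⟩ := Set.mem_iUnion₂.1 hw
    obtain ⟨v, hv, hL⟩ := L.2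
    have : w ∈ lobe E s x v := by rw [← hL]; exact hwL
    exact lobe_subset_bo hv this
  · intro a b hE ha hb
    obtain ⟨L, hLT, haL⟩ := Set.mem_iUnion₂.1 ha
    obtain ⟨v, hv, hL⟩ := L.2
    have haL' : a ∈ lobe E s x v := by rw [← hL]; exact haL
    have hbL : b ∈ lobe E s x v := lobe_closed hv hE haL' hb
    exact Set.mem_iUnion₂.2 ⟨L, hLT, by rw [hL]; exact hbL⟩

/-- a closed set is the union of the lobes it contains. [this work] -/
theorem closed_eq_union (x : Set (Sym2 V)) {S : Set V} (hS : S ⊆ bo E s x)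
    (hcl : ∀ a b, s(a, b) ∈ E → a ∈ S → b ∈ bo E s x → b ∈ S) :
    S = ⋃ L ∈ {L : {L : Set V // L ∈ Lobes E s x} | (L : Set V) ⊆ S}, (L : Set V) := by
  apply Set.Subset.antisymm
  · intro v hv
    have hvL : lobe E s x v ∈ Lobes E s x := ⟨v, hS hv, rfl⟩
    exact Set.mem_iUnion₂.2 ⟨⟨lobe E s x v, hvL⟩, lobe_subset_of_closed hcl hv, mem_lobe_self v⟩
  · intro v hv
    obtain ⟨L, hLS, hvL⟩ := Set.mem_iUnion₂.1 hv
    exact hLS hvL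

/-- the flip map is injective on unions of lobes. [this work] -/
theorem flip_injective (x : Set (Sym2 V)) {T T' : Set {L : Set V // L ∈ Lobes E s x}}
    (h : x ∆ fl E (⋃ L ∈ T, (L : Set V)) = x ∆ fl E (⋃ L ∈ T', (L : Set V))) : T = T' := by
  -- symmetric-difference cancellation: the flip sets coincide
  have hfl : fl E (⋃ L ∈ T, (L : Set V)) = fl E (⋃ L ∈ T', (L : Set V)) := symmDiff_right_injective x h
  -- key: if L ∈ T then L ∈ T'
  have key : ∀ (T T' : Set {L : Set V // L ∈ Lobes E s x}),
      fl E (⋃ L ∈ T, (L : Set V)) = fl E (⋃ L ∈ T', (L : Set V)) → T ⊆ T' := by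
    intro T T' hfl L hLT
    obtain ⟨v, hv, hL⟩ := L.2
    -- v is blue-reached in x (v ∈ bo) and v ≠ s, so v has an incident blue edge e ∈ E
    have hvb : v ∈ blue E s x := hv.1
    have hvs : v ≠ s := by
      rintro rfl
      exact hv.2 (mem_openCluster_self _ _)
    obtain ⟨p⟩ := (hvb : (openGraph (xᶜ ∩ E)).Reachable s v)
    have hadj : ∃ w, (openGraph (xᶜ ∩ E)).Adj v w := by
      cases hp : p.reverse with
      | nil => exact absurd rfl hvs
      | cons h _ => exact ⟨_, h⟩
    obtain ⟨w, hw⟩ := hadj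
    rw [openGraph_adj] at hw
    have hE : s(v, w) ∈ E := hw.1.2
    have hvL : v ∈ (L : Set V) := by rw [hL]; exact mem_lobe_self v
    have he : s(v, w) ∈ fl E (⋃ L ∈ T, (L : Set V)) := ⟨hE, v, Sym2.mem_mk_left v w, Set.mem_iUnion₂.2 ⟨L, hLT, hvL⟩⟩
    rw [hfl] at he
    obtain ⟨-, u, hu, huT'⟩ := he
    obtain ⟨L', hL'T', huL'⟩ := Set.mem_iUnion₂.1 huT'
    obtain ⟨v', hv', hL'⟩ := L'.2
    have huL'' : u ∈ lobe E s x v' := by rw [← hL']; exact huL'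
    -- v lies in L' : either u = v, or u = w is adjacent to v with v blue-only (closedness of the lobe)
    have hvL' : v ∈ lobe E s x v' := by
      rcases Sym2.mem_iff.1 hu with rfl | rfl
      · exact huL''
      · exact lobe_closed hv' (by rw [Sym2.eq_swap]; exact hE) huL'' hv
    -- hence L = L'
    have hLL' : (L : Set V) = (L' : Set V) := by
      rw [hL, hL', ← lobe_eq_of_mem hvL', lobe_eq_of_mem (mem_lobe_self (E := E) (s := s) (x := x) v)]
    have : L = L' := Subtype.ext hLL'
    rw [this]; exact hL'T'
  exact Set.Subset.antisymm (key T T' hfl) (key T' T hfl.symm)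

end Lobes

end Firm

end Antithetic

end Summit.CriticalPhenomena.PercolationContinuityZ3.Theorems
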